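import Mathlib
import Summits.ResolutionOfSingularities.ResolutionOfSingularities.Theorems.HomologicalConductorPersistenceCyclicTransferAbelianPairing
import HarnessLib

/-!
# Crux `Persistence` (stmt-16484) / rung S-2 `PersistenceSurface` (stmt-19970) — the RANK-ONE CEILING in the kernel:
# `ca³(V^G) ⊆ ⋂_χ V_[χ]·V_[χ⁻¹]` (chain W4.4b, seat res-L1-w44b-stub-4 gen 5; T-V package part 12)

[OURS · L1 w44b · rung S-2] Nothing here is a statement of the manuscript under review (Hironaka 2017);
AI-written, weaker than expert review.

WHY. Every S-2 step-2 decision of the chain (W12, Z11, E12, Z12, E13, Z13, W13; CHAIN v13.6–v13.12) is a SANDWICH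
`floor ⊆ ca(T₁) ⊆ ceiling` at the arrival `T₁ = V^H` (UAC cover `V`, `H = D(Γ)`): the FLOOR is the isotypic transfer
(parts 2–11: `𝔞_ψ^H · (ca³(V))_[ψ] ⊆ ca³(V^H)`), the CEILING is the «rank-one ceiling» `⋂_χ τ(V_χ) = ⋂_χ V_[χ]V_[χ⁻¹]`
(res-L1-w44b-tri-1 `cicert.py`, tri-2 `z13t1b`, stub-3 j281776, idea-2, plan-1 QH-TOWERS §2) — so far a COMPUTATION
resting on «each isotypic piece `V_χ` is a rank-one reflexive = MCM `V^H`-module, hence stably annihilated by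
`ca`, and `s̲ann(V_χ) = τ(V_χ) = V_χ V_{χ⁻¹}`».  This file proves that ceiling under the standard hypotheses of part 11.

THEOREM (`exists_isotypic_decomposition_of_mem_cohomologyAnnihilatorOfDegree_three`).  `U` noetherian, `V` a
noetherian NORMAL DOMAIN, module-finite over `U`, `σ : G →* (V →ₐ[U] V)` (`G` finite) with fixed ring `U`,
characters `χ x : G → U` (`x : Λ`) multiplicative with `χ x 1 = 1` and SECOND ORTHOGONALITY, `|Λ|, |G| ∈ Uˣ`,
(BIG) for every `χ x`.  Then for every `u ∈ ca³(U)` and every `x : Λ` with `V_[χ x] ≠ 0`: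
`algebraMap u = ∑_k b_k b'_k` with `b_k` of character `χ x` and `b'_k` of character `g ↦ χ x g⁻¹`
— i.e. **`ca³(U) ⊆ 𝔞₁^G := ⋂_x V_[χ x] · V_[(χ x)⁻¹]`**, EXACTLY the `ψ = 1` decomposition datum `ha` of the
transfer lemmas.  Hence the two-sided law of record (kernel): `𝔞₁^G · (ca³(V) ∩ U) ⊆ ca³(U) ⊆ 𝔞₁^G`; for `V`
REGULAR (`ca³(V) = V`, abelian quotient singularities) `ca³(V^G) = 𝔞₁^G` EXACTLY (Auslander's `MCM(V^G) = add V`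
read through stable annihilators — the law behind the chain's toric/cyclic tables and idea-1's S-b engine).

PROOF.  (1) `Hom_U(N, U)` of a finitely generated `U`-module is a SECOND SYZYGY
(`exists_isSyzygy_two_dual`: a presentation `Uᵗ → Uˢ → N → 0` dualises to
`0 → Hom(N,U) → Hom(Uˢ,U) → Hom(Uᵗ,U)`, kernel of a map between finitely generated free modules; part 5
`isSyzygy_two_ker`).  (2) By the PERFECT REYNOLDS PAIRING (part 11) `V ≅ Hom_U(V, U)` as `U`-modules, so `V|_U` is a
second syzygy and `u ∈ ca³(U)` stably annihilates it (CA1, tree `mem_cohomologyAnnihilatorOfDegree_succ_iff_forall_isSyzygy`);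
the isotypic piece `M_χ = V_[χ]` is a RETRACT of `V|_U` (projector `|G|⁻¹ P_χ`), so `u` stably annihilates `M_χ`.
(3) A free factorisation `u • id_{M_χ} = ∑_i g_i f_i` has `f_i : M_χ → U`; the extension `f_i ∘ P_χ : V → U` is a
MULTIPLICATION by some `y_i ∈ V_[χ⁻¹]` on `V_[χ]` (part 11 `exists_eq_mul_of_character_group`), so
`|G| u m = m ∑_i y_i n_i` (`n_i = g_i(e_i) ∈ M_χ`) for all `m ∈ M_χ`; cancel a nonzero `m` ((BIG)) and divide by `|G|`.

References: Iyengar–Takahashi, IMRN 2016, arXiv:1404.1476, Remark 2.13 [`IyengarTakahashi2014`]; M. Auslander,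
*Rational singularities and almost split sequences*, Trans. AMS 293 (1986) (`MCM(S^G) = add_{S^G} S`); folklore.
-/

-- single-problem summit: the doubled namespace component `ResolutionOfSingularities` is forced
set_option linter.dupNamespace false

noncomputable section

open CategoryTheory Literature.RingTheory.CohomologyAnnihilator
open Summit.ResolutionOfSingularities.ResolutionOfSingularities.Theorems.NoZeno.SandwichCluster
open Summit.ResolutionOfSingularities.ResolutionOfSingularities.Theorems.HomologicalConductor.PersistenceSurfaceHullCover
open Summit.ResolutionOfSingularities.ResolutionOfSingularities.Theorems.HomologicalConductor.PersistenceCyclicTransferSyzygy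
open Summit.ResolutionOfSingularities.ResolutionOfSingularities.Theorems.HomologicalConductor.PersistenceCyclicTransferAbelianCoinduced
open Summit.ResolutionOfSingularities.ResolutionOfSingularities.Theorems.HomologicalConductor.PersistenceCyclicTransferAbelianPairing

universe u

namespace Summit.ResolutionOfSingularities.ResolutionOfSingularities.Theorems.HomologicalConductor.PersistenceCyclicTransferAbelianCeiling

variable {U : Type u} [CommRing U]

/-! ## Duals are second syzygies -/

/-- **The dual of a finitely generated module is a second syzygy.**  `U` noetherian, `N` finitely generated:
`Hom_U(N, U) ≅ ker(Hom(Uˢ, U) → Hom(Uᵗ, U))` for a presentation `Uᵗ → Uˢ → N → 0`, so `Hom_U(N, U)` is (linearly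
equivalent to) a second syzygy of a finitely generated module. [folklore] -/
theorem exists_isSyzygy_two_dual [IsNoetherianRing U] (N : Type u) [AddCommGroup N] [Module U N] [Module.Finite U N] :
    ∃ (X K : ModuleCat.{u} U), Module.Finite U X ∧ IsSyzygy 2 X K ∧ Nonempty ((N →ₗ[U] U) ≃ₗ[U] K) := by
  classical
  obtain ⟨s, q, hq⟩ := Module.Finite.exists_fin' U N
  obtain ⟨t, q₁, hq₁⟩ := Module.Finite.exists_fin' U (LinearMap.ker q)
  let ι₁ : (Fin t → U) →ₗ[U] (Fin s → U) := (LinearMap.ker q).subtype ∘ₗ q₁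
  have hrange : LinearMap.range ι₁ = LinearMap.ker q := by
    rw [LinearMap.range_comp, LinearMap.range_eq_top.mpr hq₁, Submodule.map_top, Submodule.range_subtype]
  -- the dual map `Hom(Uˢ, U) → Hom(Uᵗ, U)`, `φ ↦ φ ∘ ι₁`
  let F : ((Fin s → U) →ₗ[U] U) →ₗ[U] ((Fin t → U) →ₗ[U] U) := LinearMap.lcomp U U ι₁
  refine ⟨ModuleCat.of U (((Fin t → U) →ₗ[U] U) ⧸ LinearMap.range F), ModuleCat.of U (LinearMap.ker F),
    inferInstance, isSyzygy_two_ker F, ⟨?_⟩⟩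
  -- `Hom(N, U) ≅ ker F` via `φ ↦ φ ∘ q`
  have hmem : ∀ φ : N →ₗ[U] U, φ ∘ₗ q ∈ LinearMap.ker F := fun φ => by
    rw [LinearMap.mem_ker]
    apply LinearMap.ext
    intro w
    change φ (q (ι₁ w)) = 0
    have : ι₁ w ∈ LinearMap.ker q := hrange ▸ LinearMap.mem_range_self ι₁ w
    rw [LinearMap.mem_ker.mp this, map_zero]
  -- descent of `ψ` with `ψ ∘ ι₁ = 0` through `q`
  have hker : ∀ ψ : (Fin s → U) →ₗ[U] U, ψ ∈ LinearMap.ker F → LinearMap.ker q ≤ LinearMap.ker ψ := by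
    intro ψ hψ v hv
    rw [← hrange] at hv
    obtain ⟨w, rfl⟩ := hv
    have := LinearMap.congr_fun (LinearMap.mem_ker.mp hψ) w
    exact this
  let e := LinearMap.quotKerEquivOfSurjective q hq
  have he : ∀ v, e.symm (q v) = Submodule.Quotient.mk v := fun v => by
    rw [LinearEquiv.symm_apply_eq, LinearMap.quotKerEquivOfSurjective_apply_mk]
  refine
    { toFun := fun φ => ⟨φ ∘ₗ q, hmem φ⟩
      map_add' := fun φ ψ => by ext; rfl
      map_smul' := fun c φ => by ext; rfl
      invFun := fun ψ => ((LinearMap.ker q).liftQ ψ.1 (hker ψ.1 ψ.2)) ∘ₗ e.symm.toLinearMap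
      left_inv := fun φ => by
        apply LinearMap.ext
        intro n
        obtain ⟨v, rfl⟩ := hq n
        dsimp only
        rw [LinearMap.comp_apply, LinearEquiv.coe_toLinearMap, he, Submodule.liftQ_apply, LinearMap.comp_apply]
      right_inv := fun ψ => by
        apply Subtype.ext
        apply LinearMap.ext
        intro v
        dsimp only
        rw [LinearMap.comp_apply, LinearMap.comp_apply, LinearEquiv.coe_toLinearMap, he, Submodule.liftQ_apply] }

/-- Stable annihilation passes to RETRACTS: `r ∘ j = id_M`, `x` stably annihilates `K` ⟹ `x` stably annihilates
`M`. [folklore] -/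
theorem stablyAnnihilates_of_retract {K M : Type u} [AddCommGroup K] [Module U K] [AddCommGroup M] [Module U M]
    (j : M →ₗ[U] K) (r : K →ₗ[U] M) (hrj : ∀ m, r (j m) = m) {x : U}
    (h : StablyAnnihilates U x (ModuleCat.of U K)) : StablyAnnihilates U x (ModuleCat.of U M) := by
  obtain ⟨s, f, g, hgf⟩ := (stablyAnnihilates_iff_exists_linearMap x (ModuleCat.of U K)).mp h
  refine stablyAnnihilates_of_linearMap (f ∘ₗ j) (r ∘ₗ g) (LinearMap.ext fun m => ?_)
  have := LinearMap.congr_fun hgf (j m)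
  simp only [LinearMap.comp_apply, LinearMap.smul_apply, LinearMap.id_apply] at this ⊢
  rw [this, LinearMap.map_smul, hrj]

/-! ## The ceiling -/

section Normal

variable {V : Type u} [CommRing V] [Algebra U V] [IsDomain V] [IsNoetherianRing V] [IsIntegrallyClosed V]
variable {G : Type*} [Group G] [Fintype G]

/-- **RANK-ONE CEILING: `ca³(V^G) ⊆ ⋂_χ V_[χ] V_[χ⁻¹]`.**  Under the standard hypotheses of part 11 (`U`
noetherian, `V` noetherian normal domain module-finite over `U`, `σ : G →* (V →ₐ[U] V)` with fixed ring `U`,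
characters `χ x` with second orthogonality, `|Λ|, |G| ∈ Uˣ`, (BIG) for every `χ x`): every `u ∈ ca³(U)` decomposes,
for every `x : Λ` with `V_[χ x] ≠ 0`, as `algebraMap u = ∑_k b_k b'_k` with `σ g b_k = χ x g · b_k`, `σ g b'_k = χ x g⁻¹ · b'_k`.
[OURS · L1 w44b] (mechanism: Auslander 1986 / Iyengar–Takahashi 2016, folklore) -/
theorem exists_isotypic_decomposition_of_mem_cohomologyAnnihilatorOfDegree_three [IsNoetherianRing U]
    [Module.Finite U V] (σ : G →* (V →ₐ[U] V))
    (hfix : ∀ v : V, (∀ g, σ g v = v) → ∃ u : U, algebraMap U V u = v)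
    (hinj : Function.Injective (algebraMap U V)) {Λ : Type*} [Fintype Λ] (χ : Λ → G → U)
    (hχone : ∀ x, χ x 1 = 1) (hχmul : ∀ x g h, χ x (g * h) = χ x g * χ x h)
    (horth : ∀ g : G, g ≠ 1 → ∑ x, χ x g = 0) (hΛU : IsUnit ((Fintype.card Λ : ℕ) : U))
    (hGU : IsUnit ((Fintype.card G : ℕ) : U))
    (hbig : ∀ (x : Λ) (P : Ideal V), P.IsPrime → P.height = 1 →
      ∃ m : V, (∀ g, σ g m = algebraMap U V (χ x g) * m) ∧ m ∉ P)
    {u : U} (hu : u ∈ cohomologyAnnihilatorOfDegree U 3) (x : Λ)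
    (hχx : ∃ m : V, (∀ g, σ g m = algebraMap U V (χ x g) * m) ∧ m ≠ 0) :
    ∃ (n : ℕ) (b b' : Fin n → V), (∀ k g, σ g (b k) = algebraMap U V (χ x g) * b k) ∧
      (∀ k g, σ g (b' k) = algebraMap U V (χ x g⁻¹) * b' k) ∧ ∑ k, b k * b' k = algebraMap U V u := by
  classical
  obtain ⟨du, hdu⟩ := hGU
  -- the isotypic piece `M_χ ⊆ V` as a `U`-submodule
  let Mχ : Submodule U V :=
    { carrier := {v | ∀ g, σ g v = algebraMap U V (χ x g) * v}
      add_mem' := fun {a b} ha hb g => by rw [map_add, ha g, hb g, mul_add]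
      zero_mem' := fun g => by rw [map_zero, mul_zero]
      smul_mem' := fun c {v} hv g => by
        rw [Algebra.smul_def, map_mul, AlgHom.commutes, hv g]
        exact mul_left_comm _ _ _ }
  have hMχ : ∀ v : V, v ∈ Mχ ↔ ∀ g, σ g v = algebraMap U V (χ x g) * v := fun _ => Iff.rfl
  -- the Reynolds operator and the projector `P_χ`
  obtain ⟨ρ, -, -, hρsum⟩ := exists_reynolds_group σ hfix hinj ⟨du, hdu⟩
  let Pr : V → V := fun v => ∑ g, algebraMap U V (χ x g⁻¹) * σ g v
  have hPrχ : ∀ v, Pr v ∈ Mχ := fun v g => apply_projector_eq_group σ χ hχmul x g v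
  have hPradd : ∀ v w, Pr (v + w) = Pr v + Pr w := fun v w => by
    change ∑ g, _ = (∑ g, _) + ∑ g, _
    rw [← Finset.sum_add_distrib]
    exact Finset.sum_congr rfl fun g _ => by rw [map_add, mul_add]
  have hPrsmul : ∀ (c : U) v, Pr (algebraMap U V c * v) = algebraMap U V c * Pr v := fun c v => by
    change ∑ g, _ = _ * ∑ g, _
    rw [Finset.mul_sum]
    exact Finset.sum_congr rfl fun g _ => by rw [map_mul, AlgHom.commutes, mul_left_comm]
  have hPrM : ∀ m ∈ Mχ, Pr m = ((Fintype.card G : ℕ) : V) * m := by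
    intro m hm
    change ∑ g, algebraMap U V (χ x g⁻¹) * σ g m = _
    have : ∀ g, algebraMap U V (χ x g⁻¹) * σ g m = m := fun g => by
      rw [(hMχ m).mp hm g, ← mul_assoc, ← map_mul, character_inv_mul χ hχone hχmul, map_one, one_mul]
    simp only [this, Finset.sum_const, Finset.card_univ, nsmul_eq_mul]
  have hduV : algebraMap U V ↑du⁻¹ * ((Fintype.card G : ℕ) : V) = 1 := by
    rw [← map_natCast (algebraMap U V), ← map_mul, Units.inv_mul_of_eq hdu, map_one]
  -- `U`-linear projector `π : V → Mχ`, `π v = |G|⁻¹ P_χ v`, with `π m = m` on `Mχ`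
  let π : V →ₗ[U] Mχ :=
    { toFun := fun v => ⟨algebraMap U V ↑du⁻¹ * Pr v, by
        rw [← Algebra.smul_def]; exact Mχ.smul_mem _ (hPrχ v)⟩
      map_add' := fun v w => by
        apply Subtype.ext
        change algebraMap U V ↑du⁻¹ * Pr (v + w) = algebraMap U V ↑du⁻¹ * Pr v + algebraMap U V ↑du⁻¹ * Pr w
        rw [hPradd, mul_add]
      map_smul' := fun c v => by
        apply Subtype.ext
        change algebraMap U V ↑du⁻¹ * Pr (c • v) = c • (algebraMap U V ↑du⁻¹ * Pr v)
        rw [Algebra.smul_def, hPrsmul, Algebra.smul_def, mul_left_comm] }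
  have hπM : ∀ m : Mχ, π (m : V) = m := fun m => by
    apply Subtype.ext
    change algebraMap U V ↑du⁻¹ * Pr (m : V) = m
    rw [hPrM m m.2, ← mul_assoc, hduV, one_mul]
  -- (1)+(2): `V|_U ≅ Hom_U(V,U)` (perfect pairing) is a second syzygy; `Mχ` is a retract of it
  let W := (ModuleCat.restrictScalars (algebraMap U V)).obj (ModuleCat.of V V)
  let toW : V → W := fun v => v
  let ofW : W → V := fun w => w
  have hpair := reynoldsPairing_existsUnique_group σ hfix hinj χ hχone hχmul horth hΛU hbig ρ hρsum
  -- the pairing map `V → Hom_U(V, U)`, `w ↦ (v ↦ ρ(v w))`, a `U`-linear bijection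
  let pr : V →ₗ[U] (W →ₗ[U] U) :=
    { toFun := fun w =>
        { toFun := fun v => ρ (ofW v * w)
          map_add' := fun v v' => by
            change ρ ((ofW v + ofW v') * w) = _
            rw [add_mul, map_add]
          map_smul' := fun c v => by
            change ρ ((algebraMap U V c * ofW v) * w) = c • ρ (ofW v * w)
            rw [mul_assoc, ← Algebra.smul_def, map_smul] }
      map_add' := fun w w' => by
        apply LinearMap.ext
        intro v
        change ρ (ofW v * (w + w')) = ρ (ofW v * w) + ρ (ofW v * w')
        rw [mul_add, map_add]
      map_smul' := fun c w => by
        apply LinearMap.ext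
        intro v
        change ρ (ofW v * (c • w)) = c • ρ (ofW v * w)
        rw [Algebra.smul_def, mul_left_comm, ← Algebra.smul_def, map_smul] }
  have hpr : ∀ w (v : V), pr w (toW v) = ρ (v * w) := fun _ _ => rfl
  have hpr_bij : Function.Bijective pr := by
    constructor
    · intro w w' h
      obtain ⟨w₀, -, huniq⟩ := hpair (pr w)
      have e1 : w = w₀ := huniq w (fun v => (hpr w v).symm)
      have e2 : w' = w₀ := huniq w' (fun v => by rw [h]; exact (hpr w' v).symm)
      rw [e1, e2]
    · intro φ
      obtain ⟨w₀, hw₀, -⟩ := hpair φ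
      exact ⟨w₀, LinearMap.ext fun v => (hw₀ (ofW v)).symm⟩
  let epr : V ≃ₗ[U] (W →ₗ[U] U) := LinearEquiv.ofBijective pr hpr_bij
  haveI : Module.Finite U W := by
    let tW : V →ₗ[U] W :=
      { toFun := toW
        map_add' := fun _ _ => rfl
        map_smul' := fun c v => by
          change toW (c • v) = toW (algebraMap U V c * v)
          rw [Algebra.smul_def] }
    exact Module.Finite.of_surjective tW fun w => ⟨ofW w, rfl⟩
  obtain ⟨X, K, hX, hK, ⟨eK⟩⟩ := exists_isSyzygy_two_dual (U := U) W
  have hsK : StablyAnnihilates U u K :=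
    (mem_cohomologyAnnihilatorOfDegree_succ_iff_forall_isSyzygy u).mp hu X K hX hK
  have hsM : StablyAnnihilates U u (ModuleCat.of U Mχ) := by
    refine stablyAnnihilates_of_retract (K := K) (M := Mχ)
      (eK.toLinearMap ∘ₗ epr.toLinearMap ∘ₗ Mχ.subtype) (π ∘ₗ epr.symm.toLinearMap ∘ₗ eK.symm.toLinearMap)
      (fun m => ?_) hsK
    simp only [LinearMap.comp_apply, LinearEquiv.coe_toLinearMap, LinearEquiv.symm_apply_apply,
      Submodule.subtype_apply]
    exact hπM m
  -- (3) a free factorisation of `u • id` on `Mχ`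
  obtain ⟨s, f, gmap, hgf⟩ := (stablyAnnihilates_iff_exists_linearMap u (ModuleCat.of U Mχ)).mp hsM
  -- components `f_i : Mχ → U`, pulled back to `V` through `P_χ`, are multiplications by `y_i ∈ V_[χ⁻¹]`
  have hext : ∀ i : Fin s, ∃ y : V, (∀ g, σ g y = algebraMap U V (χ x g⁻¹) * y) ∧
      ∀ m : Mχ, ((Fintype.card G : ℕ) : V) * algebraMap U V (f m i) = (m : V) * y := by
    intro i
    let φ : W →ₗ[U] U :=
      { toFun := fun v => f ⟨Pr (ofW v), hPrχ (ofW v)⟩ i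
        map_add' := fun v w => by
          have : (⟨Pr (ofW v + ofW w), hPrχ _⟩ : Mχ) = ⟨Pr (ofW v), hPrχ _⟩ + ⟨Pr (ofW w), hPrχ _⟩ :=
            Subtype.ext (hPradd _ _)
          change f ⟨Pr (ofW v + ofW w), hPrχ _⟩ i = f ⟨Pr (ofW v), hPrχ _⟩ i + f ⟨Pr (ofW w), hPrχ _⟩ i
          rw [this, map_add, Pi.add_apply]
        map_smul' := fun c v => by
          have : (⟨Pr (algebraMap U V c * ofW v), hPrχ _⟩ : Mχ) = c • ⟨Pr (ofW v), hPrχ _⟩ := by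
            apply Subtype.ext
            change Pr (algebraMap U V c * ofW v) = c • Pr (ofW v)
            rw [hPrsmul, Algebra.smul_def]
          change f ⟨Pr (algebraMap U V c * ofW v), hPrχ _⟩ i = c • f ⟨Pr (ofW v), hPrχ _⟩ i
          rw [this, map_smul, Pi.smul_apply] }
    obtain ⟨y, hy, hymul⟩ := exists_eq_mul_of_character_group σ hfix χ hχone hχmul x (hbig x) φ
    refine ⟨y, hy, fun m => ?_⟩
    have h1 := hymul (m : V) m.2
    have h2 : φ (toW (m : V)) = f ⟨Pr (m : V), hPrχ _⟩ i := rfl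
    have h3 : (⟨Pr (m : V), hPrχ _⟩ : Mχ) = ((Fintype.card G : ℕ) : U) • m := by
      apply Subtype.ext
      change Pr (m : V) = ((Fintype.card G : ℕ) : U) • (m : V)
      rw [hPrM m m.2, Algebra.smul_def, map_natCast]
    rw [← h1]
    change _ = algebraMap U V (φ (toW (m : V)))
    rw [h2, h3, map_smul, Pi.smul_apply, smul_eq_mul, map_mul, map_natCast]
  choose y hy hymul using hext
  -- the elements `n_i = g(e_i) ∈ Mχ`
  let nn : Fin s → V := fun i => (gmap (Pi.single i 1) : V)
  have hnn : ∀ i g, σ g (nn i) = algebraMap U V (χ x g) * nn i := fun i => (gmap (Pi.single i 1)).2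
  -- `|G| u m = m ∑ y_i n_i` on `Mχ`
  have hkey : ∀ m : Mχ, ((Fintype.card G : ℕ) : V) * (algebraMap U V u * (m : V)) = (m : V) * ∑ i, y i * nn i := by
    intro m
    have e1 : gmap (f m) = u • m := LinearMap.congr_fun hgf m
    have e2 : f m = ∑ i, f m i • Pi.single i (1 : U) := by
      ext j
      simp [Finset.sum_apply, Pi.single_apply]
    have e3 : (u • m : Mχ) = ∑ i, f m i • gmap (Pi.single i 1) := by
      rw [← e1]
      conv_lhs => rw [e2]
      rw [map_sum]
      exact Finset.sum_congr rfl fun i _ => by rw [map_smul]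
    have e4 : algebraMap U V u * (m : V) = ∑ i, algebraMap U V (f m i) * nn i := by
      have := congrArg Mχ.subtype e3
      rw [map_smul, map_sum] at this
      simp only [Submodule.subtype_apply, map_smul, Algebra.smul_def] at this
      exact this
    rw [e4, Finset.mul_sum, Finset.mul_sum]
    refine Finset.sum_congr rfl fun i _ => ?_
    rw [← mul_assoc, hymul i m]
    ring
  -- cancel a nonzero element of `Mχ`
  obtain ⟨m₀, hm₀, hm₀ne⟩ := hχx
  have hk := hkey ⟨m₀, hm₀⟩
  have hcancel : ((Fintype.card G : ℕ) : V) * algebraMap U V u = ∑ i, y i * nn i := by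
    have : m₀ * (((Fintype.card G : ℕ) : V) * algebraMap U V u - ∑ i, y i * nn i) = 0 := by
      rw [mul_sub, sub_eq_zero, ← hk]; ring
    exact sub_eq_zero.mp ((mul_eq_zero.mp this).resolve_left hm₀ne)
  refine ⟨s, nn, fun i => algebraMap U V ↑du⁻¹ * y i, hnn, fun i g => ?_, ?_⟩
  · rw [map_mul, AlgHom.commutes, hy i g, mul_left_comm]
  · calc ∑ k, nn k * (algebraMap U V ↑du⁻¹ * y k)
        = algebraMap U V ↑du⁻¹ * ∑ i, y i * nn i := by
          rw [Finset.mul_sum]; exact Finset.sum_congr rfl fun i _ => by ring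
      _ = algebraMap U V ↑du⁻¹ * (((Fintype.card G : ℕ) : V) * algebraMap U V u) := by rw [hcancel]
      _ = algebraMap U V u := by rw [← mul_assoc, hduV, one_mul]

/-- **Ceiling, bicharacter form** (`Λ = G`, `χ` a bicharacter; partner character `χ x⁻¹`). [OURS · L1 w44b] -/
theorem exists_isotypic_decomposition_of_mem_cohomologyAnnihilatorOfDegree_three_bicharacter [IsNoetherianRing U]
    [Module.Finite U V] (σ : G →* (V →ₐ[U] V))
    (hfix : ∀ v : V, (∀ g, σ g v = v) → ∃ u : U, algebraMap U V u = v)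
    (hinj : Function.Injective (algebraMap U V)) (χ : G → G → U) (hχone₁ : ∀ g, χ 1 g = 1)
    (hχmul₁ : ∀ x x' g, χ (x * x') g = χ x g * χ x' g) (hχone₂ : ∀ x, χ x 1 = 1)
    (hχmul₂ : ∀ x g h, χ x (g * h) = χ x g * χ x h) (horth : ∀ g : G, g ≠ 1 → ∑ x, χ x g = 0)
    (hGU : IsUnit ((Fintype.card G : ℕ) : U))
    (hbig : ∀ (x : G) (P : Ideal V), P.IsPrime → P.height = 1 →
      ∃ m : V, (∀ g, σ g m = algebraMap U V (χ x g) * m) ∧ m ∉ P)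
    {u : U} (hu : u ∈ cohomologyAnnihilatorOfDegree U 3) (x : G)
    (hχx : ∃ m : V, (∀ g, σ g m = algebraMap U V (χ x g) * m) ∧ m ≠ 0) :
    ∃ (n : ℕ) (b b' : Fin n → V), (∀ k g, σ g (b k) = algebraMap U V (χ x g) * b k) ∧
      (∀ k g, σ g (b' k) = algebraMap U V (χ x⁻¹ g) * b' k) ∧ ∑ k, b k * b' k = algebraMap U V u := by
  have hinv : ∀ g, χ x g⁻¹ = χ x⁻¹ g := fun g => by
    have h1 : χ x g⁻¹ * χ x g = 1 := character_inv_mul χ hχone₂ hχmul₂ x g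
    have h2 : χ x⁻¹ g * χ x g = 1 := by rw [← hχmul₁, inv_mul_cancel, hχone₁]
    calc χ x g⁻¹ = χ x g⁻¹ * (χ x⁻¹ g * χ x g) := by rw [h2, mul_one]
      _ = χ x⁻¹ g * (χ x g⁻¹ * χ x g) := by ring
      _ = χ x⁻¹ g := by rw [h1, mul_one]
  obtain ⟨n, b, b', hb, hb', hsum⟩ :=
    exists_isotypic_decomposition_of_mem_cohomologyAnnihilatorOfDegree_three σ hfix hinj χ hχone₂ hχmul₂ horth hGU
      hGU hbig hu x hχx
  exact ⟨n, b, b', hb, fun k g => by rw [← hinv]; exact hb' k g, hsum⟩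

/-- **AUSLANDER'S LAW at level `ca³` (abelian quotients of a REGULAR-LIKE cover).**  If moreover `ca³(V) = V`
(e.g. `V = k[u,v]`, `cohomologyAnnihilatorOfDegree_mvPolynomial_eq_top`) and every isotypic piece is nonzero, then
`u ∈ ca³(V^G) ⟺ algebraMap u ∈ 𝔞₁^G = ⋂_x V_[χ x]·V_[χ x⁻¹]`: FLOOR (part 11, `c = 1`) = CEILING (above).
[OURS · L1 w44b] -/
theorem mem_cohomologyAnnihilatorOfDegree_three_iff_of_eq_top [IsNoetherianRing U] [Module.Finite U V]
    (σ : G →* (V →ₐ[U] V)) (hfix : ∀ v : V, (∀ g, σ g v = v) → ∃ u : U, algebraMap U V u = v)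
    (hinj : Function.Injective (algebraMap U V)) (χ : G → G → U) (hχone₁ : ∀ g, χ 1 g = 1)
    (hχmul₁ : ∀ x x' g, χ (x * x') g = χ x g * χ x' g) (hχone₂ : ∀ x, χ x 1 = 1)
    (hχmul₂ : ∀ x g h, χ x (g * h) = χ x g * χ x h) (horth : ∀ g : G, g ≠ 1 → ∑ x, χ x g = 0)
    (hGU : IsUnit ((Fintype.card G : ℕ) : U))
    (hbig : ∀ (x : G) (P : Ideal V), P.IsPrime → P.height = 1 →
      ∃ m : V, (∀ g, σ g m = algebraMap U V (χ x g) * m) ∧ m ∉ P)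
    (hV : cohomologyAnnihilatorOfDegree V 3 = ⊤)
    (hne : ∀ x : G, ∃ m : V, (∀ g, σ g m = algebraMap U V (χ x g) * m) ∧ m ≠ 0) (u : U) :
    u ∈ cohomologyAnnihilatorOfDegree U 3 ↔
      ∀ x : G, ∃ (n : ℕ) (b b' : Fin n → V), (∀ k g, σ g (b k) = algebraMap U V (χ x g) * b k) ∧
        (∀ k g, σ g (b' k) = algebraMap U V (χ x⁻¹ g) * b' k) ∧ ∑ k, b k * b' k = algebraMap U V u := by
  constructor
  · intro hu x
    exact exists_isotypic_decomposition_of_mem_cohomologyAnnihilatorOfDegree_three_bicharacter σ hfix hinj χ hχone₁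
      hχmul₁ hχone₂ hχmul₂ horth hGU hbig hu x (hne x)
  · intro h
    refine mul_mem_cohomologyAnnihilatorOfDegree_three_of_isIntegrallyClosed_bicharacter σ hfix hinj χ hχone₁ hχmul₁
      hχone₂ hχmul₂ horth hGU hbig (c := 1) (by rw [hV]; exact Submodule.mem_top) 1
      (fun g => by rw [map_one, hχone₁, map_one, one_mul]) (a := algebraMap U V u) (fun x => ?_) u
      (by rw [mul_one])
    obtain ⟨n, b, b', hb, hb', hsum⟩ := h x
    exact ⟨n, b, b', hb, fun k g => by rw [mul_one]; exact hb' k g, hsum⟩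

end Normal

end Summit.ResolutionOfSingularities.ResolutionOfSingularities.Theorems.HomologicalConductor.PersistenceCyclicTransferAbelianCeiling

end
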